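import Summits.Ventures.PackingBounds.ThreePointCert.K13d12AggG1
import Summits.Ventures.PackingBounds.ThreePointCert.K13d12AggP
import Summits.Ventures.PackingBounds.ThreePointCert.K13d12AggM
import Summits.Ventures.PackingBounds.ThreePointCert.CheckSym2Split

/-!
# κ(13) ≤ 2080: kernel checks: constraint (i') and step (a) of the split check of (ii')

Framing: lottery ticket; floor = certified bounds/negative ranges. Venture `PackingBounds` (cell
`pub-packcert`), three-point SDP family, kissing column. Integer data / kernel checks of a feasible point of the
Bachoc–Vallentin semidefinite program (n = 13, s = 1/2, three-point matrix degree 12, two-point (Gegenbauer) part to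
degree L = 24, Bachoc–Vallentin multiplier set = cell mode sym2; exact rational certificate `sdp-n13-d12-s1-2-sym2-a24-hyb7-j141808.json`
(sha256 528063ee29f2b8195aa2d3b83a1c90c94bfacd2fca6f8246cc4bdbc5cb9eaa66) of the sdp seat's hybrid pipeline, verified by the cell's two exact verifiers), converted by
`cert2lean_g9.py` (lp gen 9; S = 68) into the units of the kernel checker `ThreePointCert.Check` + `CheckSym2` with the
record degree field set to L = 24 (the checker's degree enters only the unit `W = 2^d·d!` and the side conditions, so a
(d, L) certificate is a `Cert3` of degree L); Gram factors offset-encoded for the Kronecker-packed chunk validation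
`ThreePointCert.CheckKron`; split check of (ii') `ThreePointCert.CheckSym2Split`. Emitter `emitlean_g9s.py` (lp gen 9: coarse Gram factors `L′ ≈ L/2^k`,
expansions `4^k • zᵀ(L′L′ᵀ)z` lifted by `SoundNN.boxNonneg_smul`; layout of lp gen 8's K5d14 chain). Generated file: plain lists of integers / monomials.
-/

namespace Summit.Ventures.PackingBounds.ThreePointCert.K13d12

open Literature.Geometry.DiscreteGeometry Literature.Geometry.DiscreteGeometry.PolyCert PolyCert.SPoly

set_option maxRecDepth 100000 in
set_option maxHeartbeats 0 in
/-- The certificate passes the check of constraint `(i')`. -/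
theorem cert_I : checkI3 K13d12.cert K13d12.polys = true := by decide +kernel

set_option maxRecDepth 100000 in
set_option maxHeartbeats 0 in
/-- The certificate passes step (a) of the split check of constraint `(ii')` (Bachoc–Vallentin multiplier set): step (a): `target − E₀ − g_qE₁ cosets − M ≡ 0`. -/
theorem cert_IIa : checkII3S2a K13d12.cert K13d12.polys K13d12.polyM = true := by decide +kernel

end Summit.Ventures.PackingBounds.ThreePointCert.K13d12
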